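import Summits.QuantumFields.YangMills.Theorems.BalabanUVNodesN11TopChildO3AtRecord13
import Summits.QuantumFields.YangMills.Theorems.BalabanUVNodesN11NoExpansionTermFree
import Literature.MathematicalPhysics.QuantumFieldTheory.Balaban1983to89.Node00.Sect2RegionGeometry

/-!
# DAG node N11 — THE NEW ACTION AT THE TOP PAIR `(Ω₁, Λ₁) = (𝕋, 𝕋)` IS [I] (0.22)–(0.25)'s SMALL-FIELD EFFECTIVE ACTION: r11's (2.23) there has NO boundary terms, every `𝐄^{(1)}`- and
# `𝐑^{(1)}`-term admitted, and the running coupling telescopes back to `g₀`: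
# `A_1(𝕋,𝕋; t, a, E₁)(U) = −g₀⁻²·A(U) + Σ_{X ∈ 𝐃_1} Σ_{z ∈ X} [Re 𝐄^{(1)}(X, z; U) − Re 𝐄^{(1)}(X, z; 1)] + Σ_{X ∈ 𝐃_1} [Re 𝐑^{(1)}(X; U) − Re 𝐑^{(1)}(X; 1)] − E₁`;
# hence the MAIN TERM of N11's first 𝐓-law is, letter for letter, [I] Theorem 1 + [II] read at def-T's objects

HEADER — WORK-UNIT METADATA.  Cell `pub-ymgap`, YM-PLAN Track A (HUMAN RULING D-0062), seat `pub-ymgap-dag-n11-d` (g18; N11 [B14], s2), route `BalabanUVNodes`, item K1⁹ =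
stmt-QuantumFields-27364 (helper lane, `--kind proof --supports 27364 --as helper`, count-neutral).  [III] = [Balaban1988Convergent], [I] = [Balaban1987RG1], [II] = [Balaban1988RG2Cluster].
Over r11's `B14Eq225Concrete` ((2.23)–(2.25) WITH BODY; `smearedWilson_invSq_telescope`), 11b `Node00.Sect2FrameOfRecord` (the printed ranges `admE ∕ admR ∕ admB`), this seat's g4
`…N11NoExpansionTermFree` (the all-LARGE analogue `action23_of_forall_Omega_empty`: there `A_1 = −g₀⁻²A − E_1`) and g18 `…N11TopChildO3AtRecord13` (the top pair's (O3′)).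

WHY THIS FILE.  `…N11TopChildO3AtRecord13.firstStep_O3_top_iff` displays the main term of N11's first 𝐓-law as ONE identity whose new side is `prefactor · exp A_1(𝕋, 𝕋; u₁, (∅,0), e₁)(U_1)`
with 11c's operand still folded.  This file opens it: at the all-small pair r11's (2.41)(i) range is EMPTY (`X ∩ (Λ₁ᶜ)^∼ = X ∩ ∅^∼ = ∅`: no boundary terms `𝐁^{(1)}`), the (2.30) range is
ALL of `𝐃_1` (`X ⊆ (𝕋)^{∼−1} = 𝕋`), the (2.26)–(2.27) range is «`z ∈ X`» (`Λ₁⁰ = 𝕋`), and (2.24) telescopes (`A(1∕g_1²(·), U) + β_1(g₀)A(φ_1, U) = g₀⁻²A(U)`, so the `−β_1 A(φ_1)` of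
(2.25) cancels the running of the smeared coupling).  What is left is [I] (0.22)–(0.25)'s small-field effective action with the vacuum subtraction of (2.25) — so the displayed identity
IS [I] Theorem 1 (with [II]'s cluster expansion for `𝐄^{(1)}`) at the tree's objects, up to the supplier's optional `𝐑^{(1)}` (zero at the first step in print) and the constant.

WHAT THIS FILE PROVES (0 `def`, 0 `sorry`, standard axioms; generic setting ∕ residual ∕ term values).  §1 ranges at an all-small level `j` (`Λ_j = 𝕋`; `Ω_j = 𝕋` for 𝐁):
`innerT_univ` · `admE_of_Λ_univ` (= `decide (z ∈ X)`) · `admR_of_Λ_univ` (= `true`) · `admB_of_Λ_univ` (= `false`).  §2 along an all-small history of length `n`: `B240_of_forall_Λ_univ`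
(`𝐁_n = 0`) · `R230_of_forall_Λ_univ` (every domain) · `E225_of_forall_Λ_univ` (every `(X, z ∈ X)`, minus the counterterms) · ★★ `action23_of_allSmall` (the display above at every
length `n`, coupling `g₀` by telescoping) · ★★ `action23_one_top`.  §3 Stage 13: ★★★ `exp_action23_one_top₁₃` (`exp A_1(𝕋,𝕋)(U) = e^{−E₁}·e^{𝐄-sum + 𝐑-sum}·e^{−A(U)∕g₀²}` with the run's
`g₀`) · ★★★ `firstStep_O3_top_iff_explicit` (the main term of the first 𝐓-law with BOTH sides open: old side `∫dU δ(ŪV′⁻¹)[χ′_0(ALL)·Σ_S ζ_1(∅,∅,(∅,S))·e^{−E(p)}e^{−A(U)∕g₀²}]`, new side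
`ζ_0(∅)w_0(base₁V′) · exp(−A(U_1(V′))∕g₀² + Σ_{X,z∈X}[Re 𝐄^{(1)}(X,z;U_1(V′)) − Re 𝐄^{(1)}(X,z;1)] + Σ_X[Re 𝐑^{(1)}(X;U_1(V′)) − Re 𝐑^{(1)}(X;1)] − e₁)`, `U_1(V′)` = def-R's cured background at
the top pair).

HONEST FRAMING.  Kernel bookkeeping on r11's (2.23)–(2.25) with body and 11b's printed ranges (count-neutral); the identity stays DISPLAYED (one side of an `↔`); nothing of Bałaban
asserted; N11 NOT discharged; K1⁹ NOT closed; no registered stub touched; counts unmoved (typed 28∕28 · discharged 5∕27 · A 5∕28).  One finite `𝕋⁴_{L^K}` programme at fixed `ε = L^{−K}`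
— NOT ℝ⁴, NOT OS, NOT a mass gap, NOT Clay.  No `sorry`, `axiom`, `def`, `instance`, `notation`.  Sources (SHAPE only): [III] (2.23)–(2.27) pp.258–259, (2.30) p.260, (2.40)–(2.41)
p.261, (3.1) p.264, (3.25) p.270, Thm 1 p.262; [I] Thm 1 p.259, (0.22)–(0.25) pp.256–257, (1.27) p.253.
-/

noncomputable section

open MeasureTheory
open scoped BigOperators Matrix.Norms.L2Operator

namespace Summit.QuantumFields.YangMills.Theorems.BalabanUVNodesN11TopPairNewAction

open Literature.MathematicalPhysics.QuantumFieldTheory.Balaban1983to89 T4Continuum Node00 Node00.Tk B14.Eq218Concrete B14.Sect3Decomp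
open B15Eq112TorusCover (cover cover_surjective)
open BalabanUVNodesN11TopChildO3AtRecord13 (firstStep_O3_top_iff)
open BalabanUVNodesN11AllLargeFieldLabel (sideD_pos)

variable {F : T4Family} {N : ℕ} [NeZero N]

/-! ## §1. The printed ranges of (2.23) at an all-small level -/

section Ranges

variable {𝔸 : Type*} [NormedRing 𝔸] [NormedAlgebra ℂ 𝔸] [CompleteSpace 𝔸] {V : Type*}
variable {ν : Stage7Numerics} {M : ℕ} {g : ℕ → ℝ} {K n : ℕ}

omit [NeZero N] in
/-- `𝕋^{∼−n} = 𝕋` on the torus (the cover is onto). [cite: Balaban1988Convergent, (2.26) p.259 (bookkeeping)] -/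
theorem innerT_univ (P : Params) (s m : ℕ) : Sect2.innerT P s m (Set.univ : Set (Site P 0)) = Set.univ := by
  rw [Sect2.innerT, Set.preimage_univ, B14Sect1Sets.innerN_univ, Set.image_univ, Set.range_eq_univ.mpr (cover_surjective (P := P))]

omit [NeZero N] in
open Classical in
/-- **AT A LEVEL WITH `Λ_j = 𝕋` THE (2.26)–(2.27) RANGE IS «`z ∈ X`»** (`Λ_j⁰ = 𝕋`, `X ⊆ 𝕋`). [cite: Balaban1988Convergent, (2.26)–(2.27) p.259] -/
theorem admE_of_Λ_univ (s : SeqOfRecord F ν M g K n) {j : ℕ} (hΛ : s.Λ j = Set.univ) (Y : Set (Site (F.P K) 0)) (z : Site (F.P K) j) :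
    Sect2.admE (F.P K) ν M g s.Λ j Y z = decide (B10Eq38TorusDomains.toFine j z ∈ Y) := by
  have key : Sect2.admE (F.P K) ν M g s.Λ j Y z = true ↔ B10Eq38TorusDomains.toFine j z ∈ Y := by
    rw [Sect2.admE_eq_true_iff, Sect2.lambda0, hΛ, innerT_univ]
    exact ⟨fun h => h.2.1, fun h => ⟨Set.mem_univ _, h, Set.subset_univ _⟩⟩
  rcases Bool.eq_false_or_eq_true (Sect2.admE (F.P K) ν M g s.Λ j Y z) with h | h
  · rw [h, eq_comm, decide_eq_true_iff]; exact key.1 h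
  · rw [h, eq_comm, decide_eq_false_iff_not]; intro hz; rw [key.2 hz] at h; exact Bool.noConfusion h

omit [NeZero N] in
/-- **AT A LEVEL WITH `Λ_j = 𝕋` THE (2.30) RANGE IS ALL OF `𝐃_j`** (`Λ_j^{∼−1} = 𝕋`). [cite: Balaban1988Convergent, (2.30) p.260] -/
theorem admR_of_Λ_univ (s : SeqOfRecord F ν M g K n) {j : ℕ} (hΛ : s.Λ j = Set.univ) (Y : Set (Site (F.P K) 0)) :
    Sect2.admR (F.P K) ν M g s.Λ j Y = true :=
  (Sect2.admR_eq_true_iff _ _ _ _ _ _).2 (by rw [hΛ, innerT_univ]; exact Set.subset_univ _)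

omit [NeZero N] in
/-- **AT A LEVEL WITH `Λ_j = 𝕋` THE (2.41)(i) RANGE IS EMPTY** (`X ∩ (Λ_jᶜ)^∼ = X ∩ ∅^∼ = ∅`: NO boundary terms). [cite: Balaban1988Convergent, (2.41)(i) p.261] -/
theorem admB_of_Λ_univ (s : SeqOfRecord F ν M g K n) {j : ℕ} (hΛ : s.Λ j = Set.univ) (Y : Set (Site (F.P K) 0)) :
    Sect2.admB (F.P K) ν M g s.Ω s.Λ j Y = false := by
  rcases Bool.eq_false_or_eq_true (Sect2.admB (F.P K) ν M g s.Ω s.Λ j Y) with h | h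
  · obtain ⟨-, ⟨x, hx⟩⟩ := (Sect2.admB_eq_true_iff _ _ _ _ _ _ _).1 h
    rw [hΛ, Set.compl_univ, Sect2.enlT, Set.preimage_empty, B14Sect1Sets.enl_empty, Set.image_empty] at hx
    exact absurd hx.2 (Set.notMem_empty _)
  · exact h

end Ranges

/-! ## §2. (2.23) along an all-small history: no 𝐁, every 𝐄 and 𝐑, coupling `g₀` -/

section Action

variable {𝔸 : Type*} [NormedRing 𝔸] [NormedAlgebra ℂ 𝔸] [CompleteSpace 𝔸] {V : Type*}
variable {ν : Stage7Numerics} {M : ℕ} {g : ℕ → ℝ} {K n : ℕ}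
variable (Sg : Sect2.Setting 𝔸 (SU N)) (Rz : Sect2.Residual (F.P K) 𝔸)

/-- **`𝐁_n = 0` along a history with `Λ_j = 𝕋` for `1 ≤ j ≤ n`.** [cite: Balaban1988Convergent, (2.40)–(2.41) p.261] -/
theorem B240_of_forall_Λ_univ (s : SeqOfRecord F ν M g K n) (hΛ : ∀ j, 1 ≤ j → j ≤ n → s.Λ j = Set.univ) (t : Sect2.TermValues (F.P K) 𝔸 V M)
    (a : Tk.SFluct (F.P K) V) (U : GaugeField (F.P K) 0 (SU N)) :
    B14.Eq225Concrete.B240 (Sect2.towerOfTerms Sg Rz M s.Ω t) (fun j X => Sect2.admB (F.P K) ν M g s.Ω s.Λ j (Sect2.domSites (F.P K) M j X)) a n U = 0 := by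
  unfold B14.Eq225Concrete.B240
  refine Finset.sum_eq_zero fun j hj => Finset.sum_eq_zero fun X _ => ?_
  rw [Finset.mem_Icc] at hj
  have h := admB_of_Λ_univ s (hΛ j hj.1 hj.2) (Sect2.domSites (F.P K) M j X)
  simp only [Sect2.towerOfTerms] at h ⊢
  rw [h]
  simp

/-- **`𝐑_n(U) = Σ_{j ≤ n} Σ_{X ∈ 𝐃_j} [Re 𝐑^{(j)}(X; U) − Re 𝐑^{(j)}(X; 1)]` along such a history** — every domain admitted. [cite: Balaban1988Convergent, (2.30) p.260] -/
theorem R230_of_forall_Λ_univ (s : SeqOfRecord F ν M g K n) (hΛ : ∀ j, 1 ≤ j → j ≤ n → s.Λ j = Set.univ)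
    (t : Sect2.TermValues (F.P K) 𝔸 V M) (U : GaugeField (F.P K) 0 (SU N)) :
    B14.Eq225Concrete.R230 (Sect2.towerOfTerms Sg Rz M s.Ω t) (fun j X => Sect2.admR (F.P K) ν M g s.Λ j (Sect2.domSites (F.P K) M j X)) n U =
      ∑ j ∈ Finset.Icc 1 n, ∑ X : (Sect2.domSys (F.P K) M j).Dom,
        ((t.R j X (Sect2.ofBackgroundC Sg.ι U)).re - (t.R j X (Sect2.ofBackgroundC Sg.ι 1)).re) := by
  unfold B14.Eq225Concrete.R230
  refine Finset.sum_congr rfl fun j hj => Finset.sum_congr rfl fun X _ => ?_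
  rw [Finset.mem_Icc] at hj
  have h := admR_of_Λ_univ s (hΛ j hj.1 hj.2) (Sect2.domSites (F.P K) M j X)
  simp only [Sect2.towerOfTerms] at h ⊢
  rw [h, if_pos rfl]

open Classical in
/-- **`𝐄_n(U) = Σ_{j ≤ n} (Σ_{X ∈ 𝐃_j} Σ_{z ∈ X} [Re 𝐄^{(j)}(X, z; U) − Re 𝐄^{(j)}(X, z; 1)] − β_j(g_{j−1})·A(φ_j, U))` along such a history** — every `(X, z ∈ X)` admitted.
[cite: Balaban1988Convergent, (2.25)–(2.27) p.259] -/
theorem E225_of_forall_Λ_univ (s : SeqOfRecord F ν M g K n) (hΛ : ∀ j, 1 ≤ j → j ≤ n → s.Λ j = Set.univ) (t : Sect2.TermValues (F.P K) 𝔸 V M)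
    (U : GaugeField (F.P K) 0 (SU N)) :
    B14.Eq225Concrete.E225 (Sect2.towerOfTerms Sg Rz M s.Ω t) (fun j X z => Sect2.admE (F.P K) ν M g s.Λ j (Sect2.domSites (F.P K) M j X) z) Rz.phi n U =
      ∑ j ∈ Finset.Icc 1 n,
        ((∑ X : (Sect2.domSys (F.P K) M j).Dom, ∑ z : Site (F.P K) j,
            if decide (B10Eq38TorusDomains.toFine j z ∈ Sect2.domSites (F.P K) M j X) then
              ((t.E j X z (Sg.flow.g (j - 1)) (Sect2.ofBackgroundC Sg.ι U)).re - (t.E j X z (Sg.flow.g (j - 1)) (Sect2.ofBackgroundC Sg.ι 1)).re) else 0) -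
          Sg.flow.β j (Sg.flow.g (j - 1)) * B14.Eq225Concrete.smearedWilson (Rz.phi j) U) := by
  unfold B14.Eq225Concrete.E225 B14.Eq225Concrete.EjSub
  refine Finset.sum_congr rfl fun j hj => ?_
  rw [Finset.mem_Icc] at hj
  have h := fun (Y : Set (Site (F.P K) 0)) (z : Site (F.P K) j) => admE_of_Λ_univ s (hΛ j hj.1 hj.2) Y z
  simp only [Sect2.towerOfTerms, h]
  rfl

open Classical in
/-- ★★ **THE RENORMALIZED ACTION (2.23) ALONG THE ALL-SMALL HISTORY IS [I] (0.22)–(0.25)'s SMALL-FIELD EFFECTIVE ACTION**: for a history of length `n` with `Λ_j = 𝕋` (hence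
`Ω_j = 𝕋`) for `1 ≤ j ≤ n`, and EVERY setting, residual, term-value witness, fluctuation argument and constant,
`A_n(U) = −g₀⁻²·A(U) + Σ_{j≤n} Σ_{X∈𝐃_j} Σ_{z∈X} [Re 𝐄^{(j)}(X,z;U) − Re 𝐄^{(j)}(X,z;1)] + Σ_{j≤n} Σ_X [Re 𝐑^{(j)}(X;U) − Re 𝐑^{(j)}(X;1)] − E_n` — NO boundary terms, and (2.24)'s running of the
smeared coupling cancels (2.25)'s counterterms `−β_j A(φ_j, U)` (r11's `smearedWilson_invSq_telescope`). [cite: Balaban1988Convergent, (2.23)–(2.27) pp.258–259, (2.30) p.260, (2.40)–(2.41) p.261; Balaban1987RG1, (0.22)–(0.25) pp.256–257, (1.27) p.253] -/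
theorem action23_of_allSmall (s : SeqOfRecord F ν M g K n) (hΛ : ∀ j, 1 ≤ j → j ≤ n → s.Λ j = Set.univ)
    (t : Sect2.TermValues (F.P K) 𝔸 V M) (a : Tk.SFluct (F.P K) V) (Ek : ℝ) (U : GaugeField (F.P K) 0 (SU N)) :
    (sect2ActionDataOfRecord F N V K Sg Rz s t a Ek).action23 n U =
      -(1 / (Sg.flow.g 0) ^ 2 * wilsonAction4 U)
      + ∑ j ∈ Finset.Icc 1 n, ∑ X : (Sect2.domSys (F.P K) M j).Dom, ∑ z : Site (F.P K) j,
          (if decide (B10Eq38TorusDomains.toFine j z ∈ Sect2.domSites (F.P K) M j X) then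
            ((t.E j X z (Sg.flow.g (j - 1)) (Sect2.ofBackgroundC Sg.ι U)).re - (t.E j X z (Sg.flow.g (j - 1)) (Sect2.ofBackgroundC Sg.ι 1)).re) else 0)
      + ∑ j ∈ Finset.Icc 1 n, ∑ X : (Sect2.domSys (F.P K) M j).Dom,
          ((t.R j X (Sect2.ofBackgroundC Sg.ι U)).re - (t.R j X (Sect2.ofBackgroundC Sg.ι 1)).re)
      - Ek := by
  show (Sect2.actionDataOfTerms Sg Rz ν M g s.Ω s.Λ t n a Ek).action23 n U = _
  rw [Sect2.action23_actionDataOfTerms, E225_of_forall_Λ_univ Sg Rz s hΛ t U, R230_of_forall_Λ_univ Sg Rz s hΛ t U, B240_of_forall_Λ_univ Sg Rz s hΛ t a U,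
    Finset.sum_sub_distrib]
  have htel := B14.Eq225Concrete.smearedWilson_invSq_telescope Sg.flow Rz.phi U n
  rw [B14.Eq225Concrete.smearedWilson_invSq_zero] at htel
  linarith

open Classical in
/-- ★★ **IN PARTICULAR AT THE TOP PAIR** (a length-1 history with `Λ₁ = 𝕋`):
`A_1(𝕋,𝕋)(U) = −g₀⁻²·A(U) + Σ_{X∈𝐃_1} Σ_{z∈X} [Re 𝐄^{(1)}(X,z;U) − Re 𝐄^{(1)}(X,z;1)] + Σ_X [Re 𝐑^{(1)}(X;U) − Re 𝐑^{(1)}(X;1)] − E_1` (`𝐄^{(1)}` at the coupling `g₀`).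
[cite: Balaban1988Convergent, (2.23)–(2.27) pp.258–259, (2.30) p.260; Balaban1987RG1, Thm 1 p.259, (0.22)–(0.25) pp.256–257] -/
theorem action23_one_top (s : SeqOfRecord F ν M g K 1) (hΛ : s.Λ 1 = Set.univ)
    (t : Sect2.TermValues (F.P K) 𝔸 V M) (a : Tk.SFluct (F.P K) V) (Ek : ℝ) (U : GaugeField (F.P K) 0 (SU N)) :
    (sect2ActionDataOfRecord F N V K Sg Rz s t a Ek).action23 1 U =
      -(1 / (Sg.flow.g 0) ^ 2 * wilsonAction4 U)
      + ∑ X : (Sect2.domSys (F.P K) M 1).Dom, ∑ z : Site (F.P K) 1,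
          (if decide (B10Eq38TorusDomains.toFine 1 z ∈ Sect2.domSites (F.P K) M 1 X) then
            ((t.E 1 X z (Sg.flow.g 0) (Sect2.ofBackgroundC Sg.ι U)).re - (t.E 1 X z (Sg.flow.g 0) (Sect2.ofBackgroundC Sg.ι 1)).re) else 0)
      + ∑ X : (Sect2.domSys (F.P K) M 1).Dom, ((t.R 1 X (Sect2.ofBackgroundC Sg.ι U)).re - (t.R 1 X (Sect2.ofBackgroundC Sg.ι 1)).re)
      - Ek := by
  rw [action23_of_allSmall Sg Rz s (fun j h1 h2 => by obtain rfl : j = 1 := le_antisymm h2 h1; exact hΛ) t a Ek U, Finset.Icc_self, Finset.sum_singleton,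
    Finset.sum_singleton]

end Action

/-! ## §3. Stage 13: the exponential, and the main term of the first 𝐓-law with both sides open -/

section AtRecord

variable (θ : Stage13HParams F N) (p : B12.RunParams)

open Classical in
/-- ★★★ **`exp A_1(𝕋,𝕋)(U) = e^{−E₁} · e^{𝐄-sum(U) + 𝐑-sum(U)} · e^{−A(U)∕g₀²}`** at the Stage-13 setting of record (the run's bare coupling `g₀ = p.g0`: `genSeq_zero`), for every residual,
term-value witness and fluctuation argument, at a history `s′ = (𝕋, 𝕋)`. [cite: Balaban1988Convergent, Thm 1 p.262, (2.23)–(2.25) pp.258–259; Balaban1987RG1, Thm 1 p.259, (0.22) p.256] -/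
theorem exp_action23_one_top₁₃ (Rz : Sect2.Residual (F.P p.K) (MatA N)) (s' : SeqOfRecord F θ.ν θ.τ9.M (gOfRecord₁₃ F N θ.toStage13Params p) p.K 1)
    (hΛ : s'.Λ 1 = Set.univ) (t : Sect2.TermValues (F.P p.K) (MatA N) (FluctV N) θ.τ9.M) (a : Tk.SFluct (F.P p.K) (FluctV N)) (E₁ : ℝ) (U : GaugeField (F.P p.K) 0 (SU N)) :
    Real.exp ((sect2ActionDataOfRecord F N (FluctV N) p.K (settingOfRecord₁₃ F N θ.toStage13Params p) Rz s' t a E₁).action23 1 U) =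
      Real.exp (-E₁) *
        Real.exp (∑ X : (Sect2.domSys (F.P p.K) θ.τ9.M 1).Dom, ∑ z : Site (F.P p.K) 1,
            (if decide (B10Eq38TorusDomains.toFine 1 z ∈ Sect2.domSites (F.P p.K) θ.τ9.M 1 X) then
              ((t.E 1 X z p.g0 (Sect2.ofBackgroundC (settingOfRecord₁₃ F N θ.toStage13Params p).ι U)).re -
                (t.E 1 X z p.g0 (Sect2.ofBackgroundC (settingOfRecord₁₃ F N θ.toStage13Params p).ι 1)).re) else 0) +
          ∑ X : (Sect2.domSys (F.P p.K) θ.τ9.M 1).Dom,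
            ((t.R 1 X (Sect2.ofBackgroundC (settingOfRecord₁₃ F N θ.toStage13Params p).ι U)).re - (t.R 1 X (Sect2.ofBackgroundC (settingOfRecord₁₃ F N θ.toStage13Params p).ι 1)).re)) *
        Real.exp (-(1 / p.g0 ^ 2 * wilsonAction4 U)) := by
  rw [action23_one_top (settingOfRecord₁₃ F N θ.toStage13Params p) Rz s' hΛ t a E₁ U, settingOfRecord₁₃_flow_g]
  have h0 : gOfRecord₁₃ F N θ.toStage13Params p 0 = p.g0 := FlowStepRuns.genSeq_zero _ _
  rw [h0, ← Real.exp_add, ← Real.exp_add]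
  congr 1
  ring


open Classical in
/-- ★★★ **THE MAIN TERM OF N11's FIRST 𝐓-LAW WITH BOTH SIDES OPEN — [I] THEOREM 1 (+ [II]) AT THE TREE's OBJECTS.**  At the Stage-13 record (`1 ≤ M`), a history `s′ = (Ω₁, Λ₁) = (𝕋, 𝕋)`,
first-step term values `u₁` and constant `e₁`: clause (iii) of `FirstStepClausesAt θ p s′ u₁ e₁` IS «`𝐓ρ₀(s′) ≡ 0 ∨` for `dV′`-a.e. `V′` all of whose χ₁-cubes are (3.2)-small:
`∫dU δ(ŪV′⁻¹) [χ′_0(ALL)(U,V′) · Σ_S ζ_1(∅,∅,(∅,S))(U,V′) · ρ₀(U)] (V′)`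
 `= ζ_0(∅)(base₁V′)·w_0(𝕋,∅,∅)(base₁V′) · e^{−e₁} · exp(Σ_{X∈𝐃_1}Σ_{z∈X}[Re 𝐄^{(1)}(X,z;U_1(V′)) − Re 𝐄^{(1)}(X,z;1)] + Σ_X[Re 𝐑^{(1)}(X;U_1(V′)) − Re 𝐑^{(1)}(X;1)]) · e^{−A(U_1(V′))∕g₀²}`»,
`ρ₀ = e^{−E(p)}e^{−A∕g₀²}` (`rhoZeroOfRecord`), `U_1(V′) = UbgOfRecord₁₃CoP … 1 s′ (base-gauge₁ V′)` def-R's cured background, `𝐄^{(1)}, 𝐑^{(1)}` the supplier's terms at the coupling `g₀`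
read at `ι U_1(V′)` — [I] (0.22)–(0.25): «A_1(g_1, V) = −g₁⁻²A(U_1(V)) + 𝐄_1(U_1(V))» in r11's `g₀`-telescoped bookkeeping. [cite: Balaban1987RG1, Thm 1 p.259, (0.22)–(0.25) pp.256–257; Balaban1988Convergent, Thm 1 p.262, (3.1) p.264, (3.25) p.270, (2.23)–(2.27) pp.258–259, (2.30) p.260] -/
theorem firstStep_O3_top_iff_explicit (hM : 1 ≤ θ.τ9.M) (s' : SeqOfRecord F θ.ν θ.τ9.M (gOfRecord₁₃ F N θ.toStage13Params p) p.K 1)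
    (hΩ : s'.Ω 1 = Set.univ) (hΛ : s'.Λ 1 = Set.univ) (u₁ : Sect2.TermValues (F.P p.K) (MatA N) (FluctV N) θ.τ9.M) (e₁ : ℝ) :
    (slotsTOfRecord F N θ.ν θ.τ9 (EOfRecord₁₃ F N θ.toStage13Params) (wOfRecord₉ F N θ.toStage9Params) θ.ppSel p (gOfRecord₁₃ F N θ.toStage13Params p) 1 s' = 0 ∨
      ∀ᵐ V' ∂fieldMeasure (F.P p.K) 1 (SU N),
        chiSeqOfRecord F N θ.ν θ.τ9.M (gOfRecord₁₃ F N θ.toStage13Params p) p.K 1 s' V' ≠ 0 →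
          slotsTOfRecord F N θ.ν θ.τ9 (EOfRecord₁₃ F N θ.toStage13Params) (wOfRecord₉ F N θ.toStage9Params) θ.ppSel p (gOfRecord₁₃ F N θ.toStage13Params p) 1 s' V' =
            sect2Slot F N (FluctV N) p.K (settingOfRecord₁₃ F N θ.toStage13Params p) (θ.rzAt p s') (WtOfRecord₁₃H F N θ p s') s' u₁ e₁
              (UbgOfRecord₁₃CoP F N θ.toStage13Params p 1 s') V') ↔
    (slotsTOfRecord F N θ.ν θ.τ9 (EOfRecord₁₃ F N θ.toStage13Params) (wOfRecord₉ F N θ.toStage9Params) θ.ppSel p (gOfRecord₁₃ F N θ.toStage13Params p) 1 s' = 0 ∨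
      ∀ᵐ V' ∂fieldMeasure (F.P p.K) 1 (SU N),
        chiSeqOfRecord F N θ.ν θ.τ9.M (gOfRecord₁₃ F N θ.toStage13Params p) p.K 1 s' V' ≠ 0 →
          transportOfRecord F N p.K 0 (fun U =>
              chiPrime (sect3DataOfRecord F N θ.ν θ.τ9.M p (gOfRecord₁₃ F N θ.toStage13Params p) 0 s'.init) (avOfRecord F N p.K)
                  (2 * deltaOfRecord θ.ν (gOfRecord₁₃ F N θ.toStage13Params p) 0 θ.A₁) (Finset.univ : Finset (Iχ F θ.ν p (gOfRecord₁₃ F N θ.toStage13Params p) 0)) U V' *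
                (∑ S : Finset (Iχ F θ.ν p (gOfRecord₁₃ F N θ.toStage13Params p) 0), θ.ζ p (gOfRecord₁₃ F N θ.toStage13Params p) 0 s'.init ∅ ∅ (∅, S) U V') *
                rhoZeroOfRecord F N p.K (gOfRecord₁₃ F N θ.toStage13Params p 0) (EOfRecord₁₃ F N θ.toStage13Params p) U) V' =
            (WtOfRecord₁₃H F N θ p s').ζ 0 ∅ (baseCfg 1 V') * (WtOfRecord₁₃H F N θ p s').w 0 Set.univ ∅ ∅ (baseCfg 1 V') *
              (Real.exp (-e₁) *
                Real.exp (∑ X : (Sect2.domSys (F.P p.K) θ.τ9.M 1).Dom, ∑ z : Site (F.P p.K) 1,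
                    (if decide (B10Eq38TorusDomains.toFine 1 z ∈ Sect2.domSites (F.P p.K) θ.τ9.M 1 X) then
                      ((u₁.E 1 X z p.g0 (Sect2.ofBackgroundC (settingOfRecord₁₃ F N θ.toStage13Params p).ι
                          (UbgOfRecord₁₃CoP F N θ.toStage13Params p 1 s' (fun j => ((baseCfg (V := FluctV N) 1 V') j).1)))).re -
                        (u₁.E 1 X z p.g0 (Sect2.ofBackgroundC (settingOfRecord₁₃ F N θ.toStage13Params p).ι 1)).re) else 0) +
                  ∑ X : (Sect2.domSys (F.P p.K) θ.τ9.M 1).Dom,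
                    ((u₁.R 1 X (Sect2.ofBackgroundC (settingOfRecord₁₃ F N θ.toStage13Params p).ι
                        (UbgOfRecord₁₃CoP F N θ.toStage13Params p 1 s' (fun j => ((baseCfg (V := FluctV N) 1 V') j).1)))).re -
                      (u₁.R 1 X (Sect2.ofBackgroundC (settingOfRecord₁₃ F N θ.toStage13Params p).ι 1)).re)) *
                Real.exp (-(1 / p.g0 ^ 2 * wilsonAction4 (UbgOfRecord₁₃CoP F N θ.toStage13Params p 1 s' (fun j => ((baseCfg (V := FluctV N) 1 V') j).1)))))) := by
  rw [firstStep_O3_top_iff θ p hM s' hΩ hΛ u₁ e₁]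
  refine or_congr_right (Filter.eventually_congr (Filter.Eventually.of_forall fun V' => ?_))
  refine imp_congr_right fun _ => ?_
  rw [exp_action23_one_top₁₃ θ p (θ.rzAt p s') s' hΛ u₁ _ e₁]

end AtRecord

end Summit.QuantumFields.YangMills.Theorems.BalabanUVNodesN11TopPairNewAction

end
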